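import Summits.BirchSwinnertonDyer.BirchSwinnertonDyer.Theorems.ErratumRoadFiveIMCDivTransferDivisibleInvariants
import Summits.BirchSwinnertonDyer.Rank1Residual.X2.HidaLimitCongruenceAlgebra
import Summits.BirchSwinnertonDyer.Rank1Residual.X11b.BDPRouteOpenInputDegenerateFrame
import HarnessLib

/-!
# K2 crux 19270 `IMCDivAtErratumDataAll` (H3♭), ROAD FF — the glue at the TREE's receptacle
# `Λ = ℤ_p⟦T⟧ → Λ^{ur} = R₀⟦T⟧ → 𝓞_{ℂ_p}⟦T⟧` (`R₀ = unrIntegers p`)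

Cell `bsd-stepL`, seat `bsd-stepL-imc-p1` (g7). `--supports stmt-BirchSwinnertonDyer-19270 --as helper`.
HONEST FRAMING: BSD is not proved for any pair by this file; it closes no item; no definition, no
named fact, no `sorry`. Sequel of p470728 ∕ p474991 ∕ p475740 ∕ p476122.

The four glue files so far keep the intermediate receptacle `S` (where Krull's intersection theorem
runs) ABSTRACT: any Noetherian `Λ_𝒪`-algebra (p470728), or `𝒪'⟦T⟧` for a PID `𝒪'` receiving `𝒪`
injectively (p474991 ∕ p475740 ∕ p476122). The tree's own currency for `Λ^{ur}` is
`UnrSeries p = PowerSeries (unrIntegers p)` (`R₀ ⊂ ℂ_p`, the closure of `ℤ[μ_{p'}]`; receptacle of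
`R1.IsBDPLFunction`, of Cas18 Thm. 3.2's frame `thm32_exists_isBDPLFunction_valueAtOne`, of the
erratum fact p417695 and of imc24c's package p471038), and cell X2 proved what this needs:
`X2.HidaLimitAlgebra.isDiscreteValuationRing_unrIntegers` (`R₀` is a DVR, uniformiser `p`),
`isNoetherianRing_unrSeries`, `isLocalRing_unrSeries`, `span_C_p_le_jacobson_unrSeries`; route R1
has the structure maps `Halves.toUnr : ℤ_p → R₀`, `R1.unrToCpInt : R₀ → 𝓞_{ℂ_p}` with
`R1.unrToCpInt_comp_toUnr : unrToCpInt ∘ toUnr = R1.toCpInt`. This file SPECIALISES the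
divisible-invariants, torsion-only crux-level end form (p476122 §4) to that receptacle:
`𝒪 = ℤ_p`, `i = id`, `a = p`, `𝒪' = R₀`, `j = PowerSeries.map R1.unrToCpInt` — discharging the
receptacle hypotheses `hι`, `ha`, `hcomp` — so that the remaining hypotheses are EXACTLY the Road-FF
inputs in tree currency: D1 ∕ D2 (`ρf`, `ρg m : ContinuousRep Γ₀ Λ _`, `p`-divisible, with
`p^m`-divisible global ∕ constrained-local invariants = F5), F2 (`θ m`), F1 (`hSh`, INEQUALITY
`Ch_Λ(X^Σ_ac) ⊆ Ch_Λ(Sel^Σ(M_f)^∨)`), F7 (`hSig`, `hP`, `hLS`), F4 (`hCh m`, in `R₀⟦T⟧`), F3 (`hc m`,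
`(L_m) + (p^m) = (L^Σ_f) + (p^m)` in `R₀⟦T⟧`), torsionness of `X_f`, and the frame `Q = L_f` read in
`𝓞_{ℂ_p}⟦T⟧`. For the D1 typer: the tree also has `G_{K,S}` —
`Literature.NumberTheory.GaloisRepresentations.GaloisGroupUnramifiedOutside K S` with the continuous
quotient map `toUnramifiedQuotCont` — so the [Cas18, §2.1] model `Γ₀ = G_{K,S}`, `L₀ = {𝔭}` is
available as well as the `G_K`-with-inertia-indices model; this end form serves both.

References: [Castella2018Erratum] Lemma 2.1, Thm. 2.3, proof of Thm. 1.1 (p. 4); [Castella2018]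
§2.2, §3 (p. 9: `R₀`), (3.1), Thm. 3.1; [Skinner2016PacificMC] §3.1; [FouquetWan2021] Thm. 4.41
(PREPRINT); [Castella2020] Thm. 2.11; [JetchevSkinnerWan2017] Prop. 3.3.2, Thm. 6.1.6.
-/

noncomputable section

open scoped TensorProduct
open Literature.RingTheory.FittingIdeal Literature.NumberTheory.EllipticCurves
  Literature.NumberTheory.EllipticCurves.Module

namespace Summit.BirchSwinnertonDyer.Rank1Residual.X11b.AcSelmer.XAc

open CategoryTheory Literature.NumberTheory.GaloisRepresentations IsLocalRing NumberField
  IsDedekindDomain Field TorsionControl PowerSeries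
  Summit.BirchSwinnertonDyer.Rank1Residual.X11b.Halves
  Summit.BirchSwinnertonDyer.Rank1Residual.X2.HidaLimitAlgebra
open scoped ContRepresentation

/-- **ROAD FF, KERNEL GLUE AT THE TREE's RECEPTACLE `ℤ_p⟦T⟧ → R₀⟦T⟧ → 𝓞_{ℂ_p}⟦T⟧`.** For ANY
`W/K`, `κ`, `𝔭`, `Σ`, `γ`: from D1 ∕ D2 (`ρf`, `ρg m` over `Λ = ℤ_p⟦T⟧`, `p`-divisible, with
`p^m`-divisible global and constrained-local invariants = F5 in `selmerTorsionEquiv`'s shape),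
F2 (`θ m : M_{g_m}[p^m] ≅ M_f[p^m]`), finite generation of the dual Selmer groups, F1
(`hSh : Ch_Λ(X^Σ_ac(E[p^∞])) ⊆ Ch_Λ(Sel^Σ(M_f)^∨)`), F7 (`Ch(X^Σ_ac) = Ch(X^∅_ac)·(P_Σ)`,
`P_Σ ≠ 0` in `R₀⟦T⟧`, `(L^Σ_f) = (P_Σ·L_f)` in `R₀⟦T⟧`), F4 (`hCh m : Ch_Λ(Sel(M_{g_m})^∨)·R₀⟦T⟧ ⊆
(L_m)` when torsion — [FW21, Thm. 4.41] for the crystalline `g_m`), F3 (`hc m : (L_m) + (p^m) =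
(L^Σ_f) + (p^m)` in `R₀⟦T⟧` — [Cas20, Thm. 2.11]) and torsionness of `X_f`: the crux conjunct
`Ch_Λ(X^∅_ac)·𝓞_{ℂ_p}⟦T⟧ ⊆ (Q)` for every `Q` generating `(L_f)` in `𝓞_{ℂ_p}⟦T⟧`. The receptacle
hypotheses of p476122 §4 are DISCHARGED here: `R₀` is a DVR (X2), `(p) ⊆ Jac(R₀⟦T⟧)` (X2),
`toUnr` injective (`X11b.toUnr_injective`), `unrToCpInt ∘ toUnr = toCpInt` (R1). No erratum Lemma 2.2. CONDITIONAL on its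
hypotheses only; closes nothing; BSD proved for no pair.
[cite: Castella2018Erratum, Thm. 1.1 ⇐ Thm. 2.3, proof p. 4, read one-sidedly, Lemma 2.2 bypassed]
[cite: Castella2018, §3 (p. 9) (the receptacle R₀), (3.1) and Thm. 3.1]
[cite: Skinner2016PacificMC, §3.1 (p. 192)] [cite: JetchevSkinnerWan2017, Prop. 3.3.2 and Thm. 6.1.6 (proof)] -/
theorem map_charIdeal_le_span_of_roadFF_unr
    {K : Type} [Field K] [NumberField K] (W : WeierstrassCurve K) (p : ℕ) [Fact p.Prime]
    (κ : ZpExtension K p) (𝔭 : HeightOneSpectrum (𝓞 K)) (Sg : Set (HeightOneSpectrum (𝓞 K)))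
    (γ : absoluteGaloisGroup K) [Fact (κ.IsTopGenerator γ)]
    [TopologicalSpace (IwasawaAlgebra p)]
    -- Galois side over `Λ = ℤ_p⟦T⟧`
    {Γ₀ : Type} [Group Γ₀] [TopologicalSpace Γ₀] [IsTopologicalGroup Γ₀]
    {ι₀ : Type*} {Γw : ι₀ → Type} [∀ v, Group (Γw v)] [∀ v, TopologicalSpace (Γw v)]
    [∀ v, IsTopologicalGroup (Γw v)] (ψ : ∀ v, Γw v →ₜ* Γ₀) (L₀ : Set ι₀)
    {Mf : Type} [AddCommGroup Mf] [Module (IwasawaAlgebra p) Mf] [TopologicalSpace Mf]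
    [DiscreteTopology Mf] [ContinuousSMul (IwasawaAlgebra p) Mf]
    (ρf : ContinuousRep Γ₀ (IwasawaAlgebra p) Mf)
    (hdivf : Function.Surjective fun x : Mf => (C (p : ℤ_[p]) : IwasawaAlgebra p) • x)
    (hglobf : ∀ m, 1 ≤ m → ∀ w ∈ ρf.toTopRep.ρ.invariants,
      ∃ w' ∈ ρf.toTopRep.ρ.invariants, (C (p : ℤ_[p]) : IwasawaAlgebra p) ^ m • w' = w)
    (hlocf : ∀ m, 1 ≤ m → ∀ v ∈ L₀, ∀ w ∈ ((ρf.restrict (ψ v)).toTopRep).ρ.invariants,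
      ∃ w' ∈ ((ρf.restrict (ψ v)).toTopRep).ρ.invariants,
        (C (p : ℤ_[p]) : IwasawaAlgebra p) ^ m • w' = w)
    (Mg : ℕ → Type) [∀ m, AddCommGroup (Mg m)] [∀ m, Module (IwasawaAlgebra p) (Mg m)]
    [∀ m, TopologicalSpace (Mg m)] [∀ m, DiscreteTopology (Mg m)]
    [∀ m, ContinuousSMul (IwasawaAlgebra p) (Mg m)]
    (ρg : ∀ m, ContinuousRep Γ₀ (IwasawaAlgebra p) (Mg m))
    (hdivg : ∀ m, 1 ≤ m → Function.Surjective fun x : Mg m => (C (p : ℤ_[p]) : IwasawaAlgebra p) • x)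
    (hglobg : ∀ m, 1 ≤ m → ∀ w ∈ (ρg m).toTopRep.ρ.invariants,
      ∃ w' ∈ (ρg m).toTopRep.ρ.invariants, (C (p : ℤ_[p]) : IwasawaAlgebra p) ^ m • w' = w)
    (hlocg : ∀ m, 1 ≤ m → ∀ v ∈ L₀, ∀ w ∈ (((ρg m).restrict (ψ v)).toTopRep).ρ.invariants,
      ∃ w' ∈ (((ρg m).restrict (ψ v)).toTopRep).ρ.invariants,
        (C (p : ℤ_[p]) : IwasawaAlgebra p) ^ m • w' = w)
    (θ : ∀ m, 1 ≤ m → ((torsionRep (ρg m) ((C (p : ℤ_[p]) : IwasawaAlgebra p) ^ m)).toTopRep ≅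
      (torsionRep ρf ((C (p : ℤ_[p]) : IwasawaAlgebra p) ^ m)).toTopRep))
    [Module.Finite (IwasawaAlgebra p) (CharacterModule (selmer ψ L₀ ρf))]
    [∀ m, Module.Finite (IwasawaAlgebra p) (CharacterModule (selmer ψ L₀ (ρg m)))]
    -- F1 (Shapiro, inequality direction) and F7 (Σ-removal)
    (hSh : XAc.charIdeal W p κ 𝔭 Sg γ ≤
      Literature.NumberTheory.EllipticCurves.Module.charIdeal (IwasawaAlgebra p)
        (CharacterModule (selmer ψ L₀ ρf)))
    {PS : IwasawaAlgebra p}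
    (hSig : XAc.charIdeal W p κ 𝔭 Sg γ = XAc.charIdeal W p κ 𝔭 ∅ γ * Ideal.span {PS})
    (hP : PowerSeries.map (toUnr p) PS ≠ 0)
    {LS Lf : UnrSeries p}
    (hLS : Ideal.span {LS} = Ideal.span {PowerSeries.map (toUnr p) PS * Lf})
    -- F4 and F3 in `R₀⟦T⟧`, torsionness of `X_f`
    (Lg : ℕ → UnrSeries p)
    (hCh : ∀ m, 1 ≤ m →
      Module.IsTorsion (IwasawaAlgebra p) (CharacterModule (selmer ψ L₀ (ρg m))) →
      (Literature.NumberTheory.EllipticCurves.Module.charIdeal (IwasawaAlgebra p)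
        (CharacterModule (selmer ψ L₀ (ρg m)))).map (PowerSeries.map (toUnr p)) ≤
          Ideal.span {Lg m})
    (hc : ∀ m, 1 ≤ m →
      Ideal.span {Lg m} ⊔ (Ideal.span {(C (p : unrIntegers p) : UnrSeries p)}) ^ m =
        Ideal.span {LS} ⊔ (Ideal.span {(C (p : unrIntegers p) : UnrSeries p)}) ^ m)
    (hT : Module.IsTorsion (IwasawaAlgebra p) (CharacterModule (selmer ψ L₀ ρf)))
    -- the frame in the final receptacle
    {Q : PowerSeries 𝓞_ℂ_[p]}
    (hQ : Ideal.span {PowerSeries.map (R1.unrToCpInt p) Lf} = Ideal.span {Q}) :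
    (XAc.charIdeal W p κ 𝔭 ∅ γ).map (PowerSeries.map (R1.toCpInt p)) ≤ Ideal.span {Q} := by
  letI : Algebra ℤ_[p] (unrIntegers p) := (toUnr p).toAlgebra
  haveI := isDiscreteValuationRing_unrIntegers (p := p)
  have halg : algebraMap (IwasawaAlgebra p) (UnrSeries p) = PowerSeries.map (toUnr p) := rfl
  have hι : Function.Injective (algebraMap ℤ_[p] (unrIntegers p)) := X11b.toUnr_injective
  have hmapC : (Ideal.span {(C (p : ℤ_[p]) : IwasawaAlgebra p)}).map
      (algebraMap (IwasawaAlgebra p) (UnrSeries p)) =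
      Ideal.span {(C (p : unrIntegers p) : UnrSeries p)} := by
    rw [halg, Ideal.map_span, Set.image_singleton, map_C, map_natCast]
  have ha : (Ideal.span {(C (p : ℤ_[p]) : IwasawaAlgebra p)}).map
      (algebraMap (IwasawaAlgebra p) (UnrSeries p)) ≤ (⊥ : Ideal (UnrSeries p)).jacobson := by
    rw [hmapC]
    exact span_C_p_le_jacobson_unrSeries
  have hcomp : (PowerSeries.map (R1.unrToCpInt p)).comp
      ((algebraMap (IwasawaAlgebra p) (UnrSeries p)).comp (RingHom.id (IwasawaAlgebra p))) =
      PowerSeries.map (R1.toCpInt p) := by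
    rw [RingHom.comp_id, halg, ← PowerSeries.map_comp, R1.unrToCpInt_comp_toUnr]
  have hSh' : (XAc.charIdeal W p κ 𝔭 Sg γ).map (RingHom.id (IwasawaAlgebra p)) ≤
      Literature.NumberTheory.EllipticCurves.Module.charIdeal (IwasawaAlgebra p)
        (CharacterModule (selmer ψ L₀ ρf)) := by
    rw [Ideal.map_id]
    exact hSh
  have hP' : algebraMap (IwasawaAlgebra p) (UnrSeries p) (RingHom.id (IwasawaAlgebra p) PS) ≠ 0 := by
    rw [RingHom.id_apply, halg]
    exact hP
  have hLS' : Ideal.span {LS} =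
      Ideal.span {algebraMap (IwasawaAlgebra p) (UnrSeries p) (RingHom.id (IwasawaAlgebra p) PS) *
        Lf} := by
    rw [RingHom.id_apply, halg]
    exact hLS
  have hCh' : ∀ m, 1 ≤ m →
      Module.IsTorsion (IwasawaAlgebra p) (CharacterModule (selmer ψ L₀ (ρg m))) →
      (Literature.NumberTheory.EllipticCurves.Module.charIdeal (IwasawaAlgebra p)
        (CharacterModule (selmer ψ L₀ (ρg m)))).map
          (algebraMap (IwasawaAlgebra p) (UnrSeries p)) ≤ Ideal.span {Lg m} := by
    intro m hm ht
    rw [halg]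
    exact hCh m hm ht
  have hc' : ∀ m, 1 ≤ m →
      Ideal.span {Lg m} ⊔ ((Ideal.span {(C (p : ℤ_[p]) : IwasawaAlgebra p)}).map
        (algebraMap (IwasawaAlgebra p) (UnrSeries p))) ^ m =
      Ideal.span {LS} ⊔ ((Ideal.span {(C (p : ℤ_[p]) : IwasawaAlgebra p)}).map
        (algebraMap (IwasawaAlgebra p) (UnrSeries p))) ^ m := by
    intro m hm
    rw [hmapC]
    exact hc m hm
  exact map_charIdeal_le_span_of_roadFF_divisible W p κ 𝔭 Sg γ hι (RingHom.id (IwasawaAlgebra p))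
    (PowerSeries.map (R1.unrToCpInt p)) hcomp (C (p : ℤ_[p])) ha ψ L₀ ρf hdivf hglobf hlocf Mg ρg
    hdivg hglobg hlocg θ hSh' hSig hP' hLS' Lg hCh' hc' hT hQ

end Summit.BirchSwinnertonDyer.Rank1Residual.X11b.AcSelmer.XAc

end
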